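import Mathlib
import Literature.Analysis.ValidatedNumerics.WeightedEllOneBanach
import Literature.Analysis.Calculus.RadiiPolynomialAffine
import Literature.Computation.Certificates.RadiiPolynomialCertificate
import HarnessLib

/-!
# The contraction closing on `ℓ¹_ω` from column data

With the Banach/`ContinuousLinearMap` bridge of `…ValidatedNumerics.WeightedEllOneBanach`
(`toEll1`/`ofEll1`, `kerCLM`, `opNorm_id_sub_comp_le`), the affine closing theorem of the tree
(`Literature.Analysis.Calculus.existsUnique_affine_zero_of_norm_id_sub_le`, stated on an abstract
real Banach space) is INSTANTIATED on the weighted sequence space `ℓ¹_ω` and rewritten in the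
plain-family vocabulary (`Mem ω`, `wnorm ω`, `apply`, `ColBound`) in which certificates deliver
their numbers: existence, uniqueness and enclosure of the zero from COLUMN DATA.

## Sources and verbatim statements

* [ConstantineauGarciaAzpeitiaLessard2021] K. Constantineau, C. García-Azpeitia, J.-P. Lessard,
  Qual. Theory Dyn. Syst. 21 (2021), doi:10.1007/s12346-021-00532-3 (held `paper:arxiv-2107.05118`,
  chunk p0008 re-read 2026-08-27), Thm 3.1: "Suppose that the bounds `Y, Z = Z(r_*) > 0` satisfy
  `‖A F(ū)‖_X ≤ Y` and `sup_{z ∈ B̄_{r_*}(ū)} ‖I − A DF(z)‖_{B(X)} ≤ Z`. Define `p(r) = (Z−1)r + Y`.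
  If there exists `r₀ ∈ (0, r_*]` such that `p(r₀) < 0`, then there is a unique `ũ ∈ B_{r₀}(ū)`
  such that `F(ũ) = 0`."  Used here THROUGH the tree: its affine case (`A = I`, non-strict closing
  at `r = Y/(1 − Z)`) is `Literature.Analysis.Calculus.existsUnique_affine_zero_of_norm_id_sub_le`
  (real Banach space, `‖I − M‖ ≤ Z < 1` ⇒ `M x = c` has exactly one solution `x⋆`,
  `‖x⋆ − x̄‖ ≤ ‖M x̄ − c‖/(1 − Z)`), and the cap-nk/1 `contraction` certificate record is
  `…Certificates.RadiiPolynomialCertificate.ContractionCert` (`check`: `0 ≤ r_min ≤ r*`, `Z < 1`,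
  `Y + Z r_min ≤ r_min`).
* [HungriaLessardMirelesJames2016] Math. Comp. 85 (2016), doi:10.1090/mcom/3046 (held, re-read
  2026-08-27): Corollary 1, p. 1434 "`A ∈ B(ℓ¹_ν, ℓ¹_ν)` and `‖A‖_{B(ℓ¹_ν,ℓ¹_ν)} ≤ max(K, δ)`";
  §5.2, p. 1453 "Hence, by Corollary 1 `‖[I − AA†]c‖_ν ≤ Z^{(0)} r`."

## What is formalised (all PROVED)

* `existsUnique_of_colBound_lt_one`: `T_M : ℓ¹_ω → ℓ¹_{ω'}`, `T_A : ℓ¹_{ω'} → ℓ¹_ω` with weighted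
  column bounds, `ColBound ω ω (oneSubKer A M) Z`, `0 ≤ Z < 1` ⇒ for every `b ∈ ℓ¹_{ω'}` and
  centre `x̄ ∈ ℓ¹_ω` there is exactly one `x⋆ ∈ ℓ¹_ω` with `A(M x⋆) = A b`, and
  `‖x⋆ − x̄‖_ω ≤ ‖A(M x̄ − b)‖_ω/(1 − Z)`.
* `existsUnique_of_colBound_of_Y`: with `Y ≥ ‖A(M x̄ − b)‖_ω` and `T_A` injective on `ℓ¹_{ω'}`:
  `M x⋆ = b`, unique, `‖x⋆ − x̄‖_ω ≤ Y/(1 − Z)`.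
* `contractionCert_sound_of_colBound`: the same read off a passing cap-nk/1 `contraction`
  certificate, enclosure radius its `r_min`.

Client instance of record (QUOTED, not a theorem): certnum-ode-2, GRIDFUSION F2 step 2a route
(A) run 1 (F2-ROUTE-A (A″) steps (3), (6), (8); certificate `certA_ITER-like_nu11o10_run1.json`
sha16 8516d34e718168b5): `X = (ℓ¹_ν(cos))⁴` with the sum norm (`ι = ι' := Fin 4 × ℕ`,
`ω (r, k) := ν^k`, `ν = 11/10`); TWO weights are essential there — `M = DF̂` is a second-order
operator, bounded only into the flattened weight `ω' (r, k) := ν^k / max(1, k)²`, while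
`A = A_K ⊕ diag(1/k²)` is bounded `ℓ¹_{ω'} → ℓ¹_ω` (certnum-ode-2, 2026-08-27), so the theorems
below are used with `ω ≠ ω'` on the same index set; `Z = 0.15390 ≥ ‖I − A·DF̂‖_{ℓ¹_ω}`,
`r_min = Y/(1 − Z) ≈ 1.654e-9`; its closing sentence "F affine, `‖I − A·DF̂‖ ≤ Z < 1` ⇒ unique
`ψ⋆`, `‖ψ⋆ − ψ̄‖_X ≤ r_min`" is `existsUnique_of_colBound_of_Y` / `contractionCert_sound_of_colBound`
applied to its column data.

## What is NOT covered

No float or interval model (the column bounds, `Y` and the injectivity of `T_A` enter as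
hypotheses); only the AFFINE closing (nonlinear maps: apply `QuadraticCert.sound` /
`RadiiPolynomialTwoRadii` on `ℓ¹(ι, ℝ)` with `kerCLM`, their `hZ₂` needs a `HasFDerivAt`
statement not provided here).
-/

noncomputable section

open scoped lp
open Metric

namespace Literature.Analysis.ValidatedNumerics.WeightedSeq

variable {ι : Type*} {ω : ι → ℝ}

/-! ### 3. The contraction closing on `ℓ¹_ω` from column data -/

section Closing

variable {ι' : Type*} {ω' : ι' → ℝ}

/-- **Existence, uniqueness and enclosure in `ℓ¹_ω` from column data** (the affine closing of a
`contraction` certificate, instantiated on the weighted sequence space): if `T_M : ℓ¹_ω → ℓ¹_{ω'}`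
and `T_A : ℓ¹_{ω'} → ℓ¹_ω` have weighted column bounds and the kernel `I − A·M` has column bound
`Z < 1`, then for every `b ∈ ℓ¹_{ω'}` and every centre `x̄ ∈ ℓ¹_ω` there is exactly one
`x⋆ ∈ ℓ¹_ω` with `A(M x⋆) = A b`, and `‖x⋆ − x̄‖_ω ≤ ‖A(M x̄ − b)‖_ω / (1 − Z)`.
[cite: ConstantineauGarciaAzpeitiaLessard2021, Thm 3.1 (affine case, r = Y/(1 − Z)); HungriaLessardMirelesJames2016, Cor. 1 p. 1434 + §5.2 p. 1453] -/
theorem existsUnique_of_colBound_lt_one [DecidableEq ι] (hω : ∀ i, 0 < ω i) (hω' : ∀ j, 0 < ω' j)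
    {A : ι → ι' → ℝ} {M : ι' → ι → ℝ} {C₁ C₂ Z : ℝ} (hC₁ : 0 ≤ C₁) (hC₂ : 0 ≤ C₂) (hZ0 : 0 ≤ Z)
    (hM : ColBound ω ω' M C₁) (hA : ColBound ω' ω A C₂) (hZ : ColBound ω ω (oneSubKer A M) Z)
    (hZ1 : Z < 1) {b : ι' → ℝ} (hb : Mem ω' b) {xbar : ι → ℝ} (hxbar : Mem ω xbar) :
    ∃ xstar : ι → ℝ, Mem ω xstar ∧ apply A (apply M xstar) = apply A b ∧
      (∀ y : ι → ℝ, Mem ω y → apply A (apply M y) = apply A b → y = xstar) ∧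
      wnorm ω (xstar - xbar) ≤ wnorm ω (apply A (apply M xbar - b)) / (1 - Z) := by
  have hω0 : ∀ i, 0 ≤ ω i := fun i => (hω i).le
  have hω'0 : ∀ j, 0 ≤ ω' j := fun j => (hω' j).le
  set TM := kerCLM hω hω' hC₁ hM with hTM
  set TA := kerCLM hω' hω hC₂ hA with hTA
  obtain ⟨xs, hxs, huniq, hbound⟩ :=
    Literature.Analysis.Calculus.existsUnique_affine_zero_of_norm_id_sub_le (TA.comp TM)
      (TA (toEll1 ω' b)) (toEll1 ω xbar) (opNorm_id_sub_comp_le hω hω' hC₁ hC₂ hZ0 hM hA hZ) hZ1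
  have hMy : ∀ {y : ι → ℝ}, Mem ω y → Mem ω' (apply M y) := fun hy =>
    (wnorm_apply_le hω0 hω'0 hC₁ hM hy).1
  have hAz : ∀ {z : ι' → ℝ}, Mem ω' z → Mem ω (apply A z) := fun hz =>
    (wnorm_apply_le hω'0 hω0 hC₂ hA hz).1
  -- transport of the equation: `(T_A ∘ T_M)(toEll1 y) = T_A (toEll1 b) ↔ A(M y) = A b`
  have key : ∀ {y : ι → ℝ}, Mem ω y →
      ((TA.comp TM) (toEll1 ω y) = TA (toEll1 ω' b) ↔ apply A (apply M y) = apply A b) := by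
    intro y hy
    rw [ContinuousLinearMap.comp_apply, hTM, kerCLM_toEll1 hω hω' hC₁ hM hy, hTA,
      kerCLM_toEll1 hω' hω hC₂ hA (hMy hy), kerCLM_toEll1 hω' hω hC₂ hA hb]
    constructor
    · intro h
      have := congrArg (ofEll1 ω) h
      rwa [ofEll1_toEll1 hω (hAz (hMy hy)), ofEll1_toEll1 hω (hAz hb)] at this
    · intro h
      rw [h]
  have hxs_mem : Mem ω (ofEll1 ω xs) := mem_ofEll1 hω xs
  refine ⟨ofEll1 ω xs, hxs_mem, ?_, ?_, ?_⟩
  · exact (key hxs_mem).1 (by rw [toEll1_ofEll1 hω xs]; exact hxs)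
  · intro y hy hyeq
    have h1 : toEll1 ω y = xs := huniq _ ((key hy).2 hyeq)
    rw [← h1, ofEll1_toEll1 hω hy]
  · have e1 : wnorm ω (ofEll1 ω xs - xbar) = ‖xs - toEll1 ω xbar‖ := by
      rw [← norm_toEll1_sub_toEll1 hω hxs_mem hxbar, toEll1_ofEll1 hω xs]
    have e2 : ‖(TA.comp TM) (toEll1 ω xbar) - TA (toEll1 ω' b)‖ =
        wnorm ω (apply A (apply M xbar - b)) := by
      rw [ContinuousLinearMap.comp_apply, hTM, kerCLM_toEll1 hω hω' hC₁ hM hxbar, hTA,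
        ← map_sub, ← toEll1_sub hω' (hMy hxbar) hb,
        kerCLM_toEll1 hω' hω hC₂ hA ((hMy hxbar).sub hω'0 hb),
        norm_toEll1 hω (hAz ((hMy hxbar).sub hω'0 hb))]
    rw [e1, ← e2]
    exact hbound

/-- **The same with the certificate's numbers**: `Y ≥ ‖A(M x̄ − b)‖_ω` and `Z` as above give the
enclosure `‖x⋆ − x̄‖_ω ≤ Y/(1 − Z)` (= `r_min` of a cap-nk/1 `contraction` certificate); if `T_A`
is injective on `ℓ¹_{ω'}` the zero solves the un-preconditioned equation `M x⋆ = b`.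
[cite: ConstantineauGarciaAzpeitiaLessard2021, Thm 3.1 (affine case, r = Y/(1 − Z)); HungriaLessardMirelesJames2016, §5.2 p. 1453] -/
theorem existsUnique_of_colBound_of_Y [DecidableEq ι] (hω : ∀ i, 0 < ω i) (hω' : ∀ j, 0 < ω' j)
    {A : ι → ι' → ℝ} {M : ι' → ι → ℝ} {C₁ C₂ Z Y : ℝ} (hC₁ : 0 ≤ C₁) (hC₂ : 0 ≤ C₂) (hZ0 : 0 ≤ Z)
    (hM : ColBound ω ω' M C₁) (hA : ColBound ω' ω A C₂) (hZ : ColBound ω ω (oneSubKer A M) Z)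
    (hZ1 : Z < 1) {b : ι' → ℝ} (hb : Mem ω' b) {xbar : ι → ℝ} (hxbar : Mem ω xbar)
    (hY : wnorm ω (apply A (apply M xbar - b)) ≤ Y)
    (hAinj : ∀ z : ι' → ℝ, Mem ω' z → apply A z = 0 → z = 0) :
    ∃ xstar : ι → ℝ, Mem ω xstar ∧ apply M xstar = b ∧
      (∀ y : ι → ℝ, Mem ω y → apply M y = b → y = xstar) ∧
      wnorm ω (xstar - xbar) ≤ Y / (1 - Z) := by
  have hω0 : ∀ i, 0 ≤ ω i := fun i => (hω i).le
  have hω'0 : ∀ j, 0 ≤ ω' j := fun j => (hω' j).le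
  obtain ⟨xs, hxs, heq, huniq, hbound⟩ :=
    existsUnique_of_colBound_lt_one hω hω' hC₁ hC₂ hZ0 hM hA hZ hZ1 hb hxbar
  have hMy : ∀ {y : ι → ℝ}, Mem ω y → Mem ω' (apply M y) := fun hy =>
    (wnorm_apply_le hω0 hω'0 hC₁ hM hy).1
  refine ⟨xs, hxs, ?_, ?_, ?_⟩
  · have h1 : apply A (apply M xs - b) = 0 := by
      rw [← apply_sub hω'0 hω hC₂ hA (hMy hxs) hb, heq, sub_self]
    exact sub_eq_zero.1 (hAinj _ ((hMy hxs).sub hω'0 hb) h1)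
  · intro y hy hyb
    exact huniq y hy (by rw [hyb])
  · refine hbound.trans ?_
    exact div_le_div_of_nonneg_right hY (by linarith)

/-- **cap-nk/1 `contraction` certificate ⇒ enclosure in `ℓ¹_ω`**: a passing certificate
(`ContractionCert.check = true`: `0 ≤ r_min ≤ r*`, `Z < 1`, `Y + Z r_min ≤ r_min`) whose fields
`Y`, `Z` dominate the weighted column data yields the unique zero with `‖x⋆ − x̄‖_ω ≤ r_min`.
(`0 ≤ Z`, which `check` does not test, is a hypothesis: a column bound with a negative constant is
vacuous.) [cite: ConstantineauGarciaAzpeitiaLessard2021, Thm 3.1 (non-strict closing, contraction form); HungriaLessardMirelesJames2016, Cor. 1 p. 1434] -/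
theorem contractionCert_sound_of_colBound [DecidableEq ι]
    (c : Literature.Computation.Certificates.RadiiPolynomialCertificate.ContractionCert)
    (hc : c.check = true) (hcZ : 0 ≤ c.Z) (hω : ∀ i, 0 < ω i) (hω' : ∀ j, 0 < ω' j)
    {A : ι → ι' → ℝ} {M : ι' → ι → ℝ} {C₁ C₂ : ℝ} (hC₁ : 0 ≤ C₁) (hC₂ : 0 ≤ C₂)
    (hM : ColBound ω ω' M C₁) (hA : ColBound ω' ω A C₂)
    (hZ : ColBound ω ω (oneSubKer A M) c.Z) {b : ι' → ℝ} (hb : Mem ω' b) {xbar : ι → ℝ}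
    (hxbar : Mem ω xbar) (hY : wnorm ω (apply A (apply M xbar - b)) ≤ c.Y)
    (hAinj : ∀ z : ι' → ℝ, Mem ω' z → apply A z = 0 → z = 0) :
    ∃ xstar : ι → ℝ, Mem ω xstar ∧ apply M xstar = b ∧
      (∀ y : ι → ℝ, Mem ω y → apply M y = b → y = xstar) ∧
      wnorm ω (xstar - xbar) ≤ c.rmin := by
  obtain ⟨h0, -, h2, h3⟩ := c.check_eq_true_iff.1 hc
  have h0' : (0 : ℝ) ≤ c.rmin := by exact_mod_cast h0
  have h2' : (c.Z : ℝ) < 1 := by exact_mod_cast h2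
  have h3' : (c.Y : ℝ) + c.Z * c.rmin ≤ c.rmin := by exact_mod_cast h3
  have hZ0 : (0 : ℝ) ≤ c.Z := by exact_mod_cast hcZ
  obtain ⟨xs, hxs, heq, huniq, hbound⟩ :=
    existsUnique_of_colBound_of_Y hω hω' hC₁ hC₂ hZ0 hM hA hZ h2' hb hxbar hY hAinj
  refine ⟨xs, hxs, heq, huniq, hbound.trans ?_⟩
  rw [div_le_iff₀ (by linarith)]
  nlinarith [h3', h0']

end Closing

end Literature.Analysis.ValidatedNumerics.WeightedSeq

end
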